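import Summits.ABC.IUTFork.Conditional.WRowFrey283Packages
import Literature.IUT.LogVolume.UnitLogInnerRadiusTie
import HarnessLib

/-!
# R-W WINDOW-TABLE, W1 ROW DECISIONS (inhabited side) — the known abc triple `1 + 3¹⁶·7 = 2³·11·23·53³`:
# pole orders of `j(1/c)`, the bad primes of a genuine Θ-volume datum over it, and the tie inner witness at `p ∤ A`

PROOF-ONLY file (D-0012; 0 definitions, 0 `Prop` facts) of the abc-iut cell — D-0079 RESCUE sub-cell R-W «WINDOW Θ-SIDE INEQUALITY», W1 ROW
DECISIONS composer seat abc-iut-W-row-1 (gen 0); packages for row 4 of HOME/plan/rescue/R-W/OPEN-10.md (sha16 1b0025ee7a8ba6d7):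
`pilotDataOfK:frey-1-301327047-301327048:23`. TAKES NO SIDE on [IUTchIII] Cor. 3.12 or on any author.

WHAT IS PROVED (namespace `Summit.ABC.IUTFork.Conditional`): `WRow.inner_witness_tie_of_not_dvd` — at a tie index `e = A·(p−1)` with
`p ∤ A` the LOWER tie reading `ρin = A`: `ϖ^{A−1} ∉ log_p(𝒪^×)` (abc-iut-c312-3's `not_closedBall_pred_subset_logUnits`; both tie readings of the
table's col 29 are thereby covered on the inhabited side); `isABCTriple_frey301327048`; the exact pole orders `ord_p j(1/c) = −2·v_p(abc)` at
`p ∈ {3, 7, 11, 23, 53}` (`Corollary22RatPointDictionary`); `WRow.bad_prime_frey301327048` — a bad fibre point of a genuine Θ-volume datum over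
`(ratPoint (1/301327048), l)` lies over `{3, 7, 11, 23, 53} ∖ {l}`. Consumer: `WRowFrey301327048TwentyThree.lean`. HONEST SCOPE: classical
bookkeeping on OUR typed objects; nothing about the printed inequality; typed ≠ proved; no abc claim.
[cite: Mochizuki2012, IUTchI Ex. 3.2 (iv) p. 71; IUTchIV Cor. 2.2 (ii) proof (P5) p. 46] [cite: SilvermanAEC2009, Prop. III.1.7(b)]
[cite: NeukirchANT1999, Ch. II (5.5)] [claim: Mochizuki2012, status: disputed] for every IUT sentence.
-/

noncomputable section

open Set Function Metric NumberField IsDedekindDomain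

namespace Summit.ABC.IUTFork.Conditional

open Thm311 Thm311.Real Cor312 Cor312Vol Cor312Prov Literature.IUT.LogThetaLattice Literature.IUT.LogVolume
  Literature.IUT.HodgeTheaters Literature.IUT.LogVolume.Cor22
open Literature.NumberTheory.NumberFields Literature.NumberTheory.GaloisRepresentations.Ultrametric
open Literature.NumberTheory.DiophantineGeometry Literature.NumberTheory.DiophantineGeometry.GenEll

/-! ## §1. The tie inner witness at `p ∤ A` (lower reading) -/

section LocalPackages

variable (p : ℕ) [Fact p.Prime] (K : Type) [NontriviallyNormedField K] [instK : NormedAlgebra ℚ_[p] K] [IsUltrametricDist K]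
  [ProperSpace K]

include instK in
/-- **Inner witness at a tie index `e = A·(p−1)`, `p ∤ A` (LOWER reading `ρin = A`)**: `ϖ^{A−1}` is not a logarithm, so some `z ∉ log_p(𝒪_K^×)`
has `‖z‖ ≤ p^{−(A−1)/e}` (abc-iut-c312-3's `not_closedBall_pred_subset_logUnits`; the upper reading `A + 1` holds iff `ζ_p ∈ K`, not needed on
the inhabited side). [cite: NeukirchANT1999, Ch. II (5.5)] -/
theorem WRow.inner_witness_tie_of_not_dvd {e : ℕ} (he : absRamificationIdx p K = e) (A : ℕ) (hA : e = A * (p - 1)) (hpA : ¬ p ∣ A) :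
    ∃ z : K, z ∉ logUnits K ∧ ‖z‖ ≤ (p : ℝ) ^ (-((((A : ℤ) : ℝ) - 1) / (e : ℝ))) := by
  obtain ⟨ϖ, hϖ⟩ := exists_isUniformizer (F := K)
  have hA' : absRamificationIdx p K = A * (p - 1) := he.trans hA
  have hA1 : 1 ≤ A := by
    rcases Nat.eq_zero_or_pos A with h0 | h0
    · exfalso
      have := absRamificationIdx_pos p K
      rw [hA', h0, zero_mul] at this
      exact lt_irrefl 0 this
    · exact h0
  obtain ⟨z, hz, hzΛ⟩ := not_subset.mp (LogEnvelope.not_closedBall_pred_subset_logUnits p hϖ hA' hpA)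
  refine ⟨z, hzΛ, ?_⟩
  rw [mem_closedBall, dist_zero_right, ← zpow_natCast, RamificationCriterion.norm_unif_zpow_eq_rpow p hϖ, he] at hz
  convert hz using 2
  rw [Nat.cast_sub hA1]
  push_cast
  ring

end LocalPackages

/-! ## §2. The triple `1 + 3¹⁶·7 = 2³·11·23·53³`: pole orders of `j(1/c)` and the bad primes -/

section Triple

/-- `1 + 3¹⁶·7 = 2³·11·23·53³` (`= 8251953408`) is an abc triple. [folklore] -/
theorem isABCTriple_frey301327048 : IsABCTriple 1 301327047 301327048 := by
  refine ⟨by norm_num, by norm_num, by norm_num, ?_⟩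
  rw [Nat.coprime_iff_gcd_eq_one]
  decide

/-- The denominator of `j(1/c)`: `(abc)² = 2⁶·3³²·7²·11²·23²·53⁶`. [folklore] -/
theorem WRow.den_frey301327048 :
    (1 * 301327047 * 301327048) ^ 2 =
      ∏ p ∈ ({2, 3, 7, 11, 23, 53} : Finset ℕ),
        p ^ (if p = 2 then 6 else if p = 3 then 32 else if p = 7 then 2 else if p = 11 then 2 else if p = 23 then 2 else 6) := by
  decide

/-- **`ord_p j(1/c) = −2·v_p(abc)`** at the places of `ℚ` over `p ∈ {3, 7, 11, 23, 53}` (Frey formula + the rational-point dictionary).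
[cite: SilvermanAEC2009, Prop. III.1.7(b)] [cite: MochizukiGenEll2010, Def. 3.3 p. 12] -/
theorem WRow.ord_jInv_frey301327048 (v : HeightOneSpectrum (𝓞 ℚ)) {p₀ : ℕ} (hv : Rat.HeightOneSpectrum.natGenerator v = p₀)
    (hp₀ : p₀ = 3 ∨ p₀ = 7 ∨ p₀ = 11 ∨ p₀ = 23 ∨ p₀ = 53) :
    ord ℚ v (jInv ((1 : ℚ) / 301327048)) =
      -((if p₀ = 2 then 6 else if p₀ = 3 then 32 else if p₀ = 7 then 2 else if p₀ = 11 then 2 else if p₀ = 23 then 2 else 6 : ℕ) : ℤ) := by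
  have hj : jInv ((1 : ℚ) / 301327048) =
      ((256 * (301327048 * 301327047 + 1 * 1) ^ 3 : ℕ) : ℚ) / (((1 * 301327047 * 301327048) ^ 2 : ℕ) : ℚ) := by
    have h := jInv_ratPoint_triple isABCTriple_frey301327048
    push_cast at h ⊢
    exact h
  have hI : ∀ p ∈ ({2, 3, 7, 11, 23, 53} : Finset ℕ), p.Prime := by
    intro p hp
    simp only [Finset.mem_insert, Finset.mem_singleton] at hp
    rcases hp with rfl | rfl | rfl | rfl | rfl | rfl <;> norm_num
  have hmem : p₀ ∈ ({2, 3, 7, 11, 23, 53} : Finset ℕ) := by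
    simp only [Finset.mem_insert, Finset.mem_singleton]
    rcases hp₀ with h | h | h | h | h <;> simp [h]
  have hcop : ¬ p₀ ∣ 256 * (301327048 * 301327047 + 1 * 1) ^ 3 := by
    rcases hp₀ with rfl | rfl | rfl | rfl | rfl <;> norm_num
  subst hv
  exact ord_jInv_ratPoint_of_mem hI WRow.den_frey301327048 hj (by norm_num) v hmem hcop

/-- The POLES of `j(1/c)` lie over `{2, 3, 7, 11, 23, 53}`. [cite: MochizukiGenEll2010, Def. 3.3 p. 12] -/
theorem WRow.natGenerator_mem_of_ord_neg_frey301327048 (v : HeightOneSpectrum (𝓞 ℚ)) (hneg : ord ℚ v (jInv ((1 : ℚ) / 301327048)) < 0) :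
    Rat.HeightOneSpectrum.natGenerator v ∈ ({2, 3, 7, 11, 23, 53} : Finset ℕ) := by
  by_contra hv
  have hj : jInv ((1 : ℚ) / 301327048) =
      ((256 * (301327048 * 301327047 + 1 * 1) ^ 3 : ℕ) : ℚ) / (((1 * 301327047 * 301327048) ^ 2 : ℕ) : ℚ) := by
    have h := jInv_ratPoint_triple isABCTriple_frey301327048
    push_cast at h ⊢
    exact h
  have hI : ∀ p ∈ ({2, 3, 7, 11, 23, 53} : Finset ℕ), p.Prime := by
    intro p hp
    simp only [Finset.mem_insert, Finset.mem_singleton] at hp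
    rcases hp with rfl | rfl | rfl | rfl | rfl | rfl <;> norm_num
  have := ord_jInv_ratPoint_nonneg_of_not_mem hI WRow.den_frey301327048 hj (by norm_num) v hv
  omega

end Triple

/-! ## §3. Which primes carry the bad fibre points -/

/-- **Which primes carry bad fibre points at `(ratPoint (1/c), l)`, `c = 2³·11·23·53³`, and the pole order there**: a bad `x | p` forces
`p ∈ {3, 7, 11, 23, 53} ∖ {l}` (`‖t_q(x)‖ < 1` for the chosen realising q-idele, i.e. a pole of `j`; `p ≠ 2, l`) and `ord_p j(1/c) = −2·v_p(abc)`.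
[cite: Mochizuki2012, IUTchIV Cor. 2.2 (ii) proof (P5) p. 46] -/
theorem WRow.bad_prime_frey301327048 {l : ℕ} (T : Cor22.ThetaVolumeDatumAt (ratPoint ((1 : ℚ) / 301327048)) l) (pp : Nat.Primes) :
    letI := T.instFieldF; letI := T.instNumberFieldF; letI := T.instAlgebraF; letI := T.instFieldK
    letI := T.instNumberFieldK; letI := T.instAlgebraK; letI := T.instFieldFbar; letI := T.instAlgebraFbar
    letI := T.instAlgebraKFbar; letI := T.instIsElliptic
    haveI : Fact (pp : ℕ).Prime := ⟨pp.2⟩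
    ∀ x : (thetaIndex (pilotDataOfK T.D T.K)).Fibre (.inr pp), placeOf (pilotDataOfK T.D T.K) pp.1 x ∈ (pilotDataOfK T.D T.K).S →
      (pp : ℕ) ≠ l ∧ (((pp : ℕ) = 3 ∧ ord ℚ (finBelow ℚ T.K (placeOf (pilotDataOfK T.D T.K) pp.1 x)) (jInv ((1 : ℚ) / 301327048)) = -32) ∨
      ((pp : ℕ) = 7 ∧ ord ℚ (finBelow ℚ T.K (placeOf (pilotDataOfK T.D T.K) pp.1 x)) (jInv ((1 : ℚ) / 301327048)) = -2) ∨
      ((pp : ℕ) = 11 ∧ ord ℚ (finBelow ℚ T.K (placeOf (pilotDataOfK T.D T.K) pp.1 x)) (jInv ((1 : ℚ) / 301327048)) = -2) ∨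
      ((pp : ℕ) = 23 ∧ ord ℚ (finBelow ℚ T.K (placeOf (pilotDataOfK T.D T.K) pp.1 x)) (jInv ((1 : ℚ) / 301327048)) = -2) ∨
      ((pp : ℕ) = 53 ∧ ord ℚ (finBelow ℚ T.K (placeOf (pilotDataOfK T.D T.K) pp.1 x)) (jInv ((1 : ℚ) / 301327048)) = -6)) := by
  letI := T.instFieldF; letI := T.instNumberFieldF; letI := T.instAlgebraF; letI := T.instFieldK
  letI := T.instNumberFieldK; letI := T.instAlgebraK; letI := T.instFieldFbar; letI := T.instAlgebraFbar
  letI := T.instAlgebraKFbar; letI := T.instIsElliptic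
  haveI : Fact (pp : ℕ).Prime := ⟨pp.2⟩
  intro x hx
  have hjF : T.E.j = ((jInv ((1 : ℚ) / 301327048) : ℚ) : T.F) := by rw [T.j_eq]; exact eq_ratCast _ _
  have hp1 : (1 : ℝ) < ((pp : ℕ) : ℝ) := by exact_mod_cast pp.2.one_lt
  have hgen := natGenerator_finBelow_placeOf T.D pp x
  -- a pole of `j` under the bad place
  have hneg : ord ℚ (finBelow ℚ T.K (placeOf (pilotDataOfK T.D T.K) pp.1 x)) (jInv ((1 : ℚ) / 301327048)) < 0 := by
    have hlt := norm_chosenQIdele_lt_one T.D pp x hx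
    rw [norm_chosenQIdele_eq_rpow_ord_rat' T.D pp x hx _ hjF] at hlt
    by_contra hge
    push Not at hge
    have hl : (0 : ℝ) < 2 * (l : ℕ) := by
      have : 0 < l := lt_of_lt_of_le (by norm_num) T.D.five_le_l
      positivity
    have hexp : (0 : ℝ) ≤ (ord ℚ (finBelow ℚ T.K (placeOf (pilotDataOfK T.D T.K) pp.1 x)) (jInv ((1 : ℚ) / 301327048)) : ℝ) /
        (2 * (l : ℕ)) := div_nonneg (by exact_mod_cast hge) hl.le
    have h1 := (Real.rpow_le_rpow_left_iff hp1).mpr hexp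
    rw [Real.rpow_zero] at h1
    linarith
  have hmem := WRow.natGenerator_mem_of_ord_neg_frey301327048 _ hneg
  rw [hgen] at hmem
  obtain ⟨h2, hl'⟩ := ne_two_and_ne_l_of_placeOf_mem_S_pilotDataOfK T.D pp x hx
  refine ⟨hl', ?_⟩
  simp only [Finset.mem_insert, Finset.mem_singleton] at hmem
  have hord : ∀ {p₀ : ℕ}, (pp : ℕ) = p₀ → (p₀ = 3 ∨ p₀ = 7 ∨ p₀ = 11 ∨ p₀ = 23 ∨ p₀ = 53) →
      ord ℚ (finBelow ℚ T.K (placeOf (pilotDataOfK T.D T.K) pp.1 x)) (jInv ((1 : ℚ) / 301327048)) =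
        -((if p₀ = 2 then 6 else if p₀ = 3 then 32 else if p₀ = 7 then 2 else if p₀ = 11 then 2 else if p₀ = 23 then 2 else 6 : ℕ) : ℤ) :=
    fun hp hp₀ => WRow.ord_jInv_frey301327048 _ (hgen.trans hp) hp₀
  rcases hmem with h | h | h | h | h | h
  · exact absurd h h2
  · exact Or.inl ⟨h, by simpa using hord h (by norm_num)⟩
  · exact Or.inr (Or.inl ⟨h, by simpa using hord h (by norm_num)⟩)
  · exact Or.inr (Or.inr (Or.inl ⟨h, by simpa using hord h (by norm_num)⟩))
  · exact Or.inr (Or.inr (Or.inr (Or.inl ⟨h, by simpa using hord h (by norm_num)⟩)))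
  · exact Or.inr (Or.inr (Or.inr (Or.inr ⟨h, by simpa using hord h (by norm_num)⟩)))

end Summit.ABC.IUTFork.Conditional

end
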